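import Literature.LinearAlgebra.Matrix.ShortPlueckerRelation
import HarnessLib

/-!
# The quadratic and short Plücker relations (Fallat–Johnson 2011, §1.2) — proofs

Topic `Literature/LinearAlgebra/Matrix`. Sibling proof file of `ShortPlueckerRelation.lean`: it
DISCHARGES the two named facts stated there,

* `FallatJohnson2011_plueckerRelations_one` — the quadratic (Plücker) relations, case `s = 1`:
  `[i₁, …, iₙ][j₁, …, jₙ] = Σ_t [j_t, i₂, …, iₙ][j₁, …, j_{t−1}, i₁, j_{t+1}, …, jₙ]` for maximal
  minors of a matrix `B` (rows in the order written), as `FallatJohnson2011_plueckerRelations_one_holds`;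
* `FallatJohnson2011_shortPlueckerRelation` — the short (three-term) relation
  `[i,i',Δ][j,j',Δ] + [i,j',Δ][i',j,Δ] = [i,j,Δ][i',j',Δ]`, as
  `FallatJohnson2011_shortPlueckerRelation_holds`;

both over an arbitrary commutative ring, for the route `MatrixMultiplication/CondensationDistance`
(cruxes `CondensationSound`, `ShortCondensation`, …) and `LongExchangeCondensation`.

## The printed statements and this formalisation

Fallat–Johnson, *Totally Nonnegative Matrices* (2011), §1.2 (PDF pp. 36–37) state the quadratic
relations for the Plücker coordinates of a `2n × n` matrix and derive from the `s = 1` relation, in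
which "only the terms `t = 1, 2` survive" once repeated indices kill a coordinate and switched indices
negate it, "the short Plücker relation". We follow exactly this:

1. `FallatJohnson2011_plueckerRelations_one_holds`: the `s = 1` relation is Cramer's rule
   `det(v) · u = Σ_t det(v₁, …, v_{t−1}, u, v_{t+1}, …, vₙ) · v_t` for the rows `v_t = B_{j_t}` and
   `u = B_{i₁}` (`Matrix.mulVec_cramer`, over any commutative ring), followed by the linear functional
   `w ↦ det(w, B_{i₂}, …, B_{iₙ})` (linearity of `det` in one row, `Matrix.det_updateRow_add/smul`).
2. `FallatJohnson2011_shortPlueckerRelation_holds`: specialise 1 to `I = (i, i', Δ)`, `J = (j, j', Δ)`;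
   the terms `t ≥ 3` contain the repeated row `Δ_s` (`Matrix.det_zero_of_row_eq`), and the two
   surviving terms are rewritten with `[y, x, Δ] = −[x, y, Δ]` (`plueckerCoord_swap`, a row
   transposition, `Matrix.det_permute`).

No new definitions and no new named facts are introduced.

## References

* S. M. Fallat, C. R. Johnson, *Totally Nonnegative Matrices*, Princeton UP 2011, §1.2: the
  quadratic relations for Plücker coordinates and "the short Plücker relation" (PDF pp. 36–37).
  [FallatJohnson2011]
-/

noncomputable section

namespace Literature.LinearAlgebra.Matrix

open scoped BigOperators

namespace ShortPluecker

variable {R : Type*} [CommRing R] {n : ℕ}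

/-- `det` is additive along a finite linear combination placed in one row:
`det(M[r ↦ Σ_t c_t w_t]) = Σ_t c_t det(M[r ↦ w_t])`.
[cite: FallatJohnson2011, §1.2 (multilinearity of the maximal minors)] -/
theorem det_updateRow_sum {ι : Type*} (s : Finset ι) (M : _root_.Matrix (Fin n) (Fin n) R)
    (r : Fin n) (c : ι → R) (w : ι → Fin n → R) :
    (M.updateRow r (∑ t ∈ s, c t • w t)).det = ∑ t ∈ s, c t * (M.updateRow r (w t)).det := by
  classical
  induction s using Finset.induction_on with
  | empty =>
    rw [Finset.sum_empty, Finset.sum_empty]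
    exact _root_.Matrix.det_eq_zero_of_row_eq_zero r fun j => by
      rw [_root_.Matrix.updateRow_apply, if_pos rfl, Pi.zero_apply]
  | @insert a s ha ih =>
    rw [Finset.sum_insert ha, Finset.sum_insert ha, _root_.Matrix.det_updateRow_add,
      _root_.Matrix.det_updateRow_smul, ih]

/-- Swapping the two leading row indices negates the Plücker coordinate: `[y, x, Δ] = −[x, y, Δ]`
("if two indices are switched, the coordinate is negated").
[cite: FallatJohnson2011, §1.2 (PDF p. 36)] -/
theorem plueckerCoord_swap {m N : ℕ} (B : _root_.Matrix (Fin N) (Fin (m + 2)) R) (Δ : Fin m → Fin N)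
    (x y : Fin N) : plueckerCoord B Δ y x = -plueckerCoord B Δ x y := by
  classical
  unfold plueckerCoord
  have hM : (_root_.Matrix.of (Fin.cons (B y) (Fin.cons (B x) fun t => B (Δ t))) :
        _root_.Matrix (Fin (m + 2)) (Fin (m + 2)) R) =
      (_root_.Matrix.of (Fin.cons (B x) (Fin.cons (B y) fun t => B (Δ t)) :
        _root_.Matrix (Fin (m + 2)) (Fin (m + 2)) R)).submatrix (Equiv.swap 0 1) id := by
    ext a b
    simp only [_root_.Matrix.submatrix_apply, _root_.Matrix.of_apply, id]
    refine Fin.cases ?_ (fun a' => ?_) a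
    · rw [Equiv.swap_apply_left, Fin.cons_zero, Fin.cons_one, Fin.cons_zero]
    · refine Fin.cases ?_ (fun s => ?_) a'
      · rw [show (Fin.succ 0 : Fin (m + 2)) = 1 from rfl, Equiv.swap_apply_right, Fin.cons_one,
          Fin.cons_zero, Fin.cons_zero]
      · have h0 : (s.succ.succ : Fin (m + 2)) ≠ 0 := Fin.succ_ne_zero _
        have h1 : (s.succ.succ : Fin (m + 2)) ≠ 1 := by
          rw [show (1 : Fin (m + 2)) = Fin.succ 0 from rfl]
          exact fun h => Fin.succ_ne_zero _ (Fin.succ_injective _ h)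
        rw [Equiv.swap_apply_of_ne_of_ne h0 h1, Fin.cons_succ, Fin.cons_succ, Fin.cons_succ,
          Fin.cons_succ]
  rw [hM, _root_.Matrix.det_permute, Equiv.Perm.sign_swap (zero_ne_one : (0 : Fin (m + 2)) ≠ 1)]
  simp

end ShortPluecker

/-! ### The discharges -/

/-- **DISCHARGE of `FallatJohnson2011_plueckerRelations_one`** (Fallat–Johnson 2011, §1.2, the
quadratic relation `s = 1`): `[i₁, …, iₙ][j₁, …, jₙ] = Σ_t [j_t, i₂, …, iₙ][j₁, …, i₁ (t-th), …, jₙ]`,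
over any commutative ring. Proof: Cramer's rule for the rows `B_{j_t}` and the vector `B_{i₁}`,
followed by the linear functional `det(·, B_{i₂}, …, B_{iₙ})`.
[cite: FallatJohnson2011, §1.2, the quadratic relations for Plücker coordinates (PDF p. 36)] -/
theorem FallatJohnson2011_plueckerRelations_one_holds : FallatJohnson2011_plueckerRelations_one := by
  intro R _ n N B I J h
  classical
  set MI : _root_.Matrix (Fin n) (Fin n) R := _root_.Matrix.of fun a => B (I a) with hMI
  set MJ : _root_.Matrix (Fin n) (Fin n) R := _root_.Matrix.of fun a => B (J a) with hMJ
  -- Cramer's rule for `MJᵀ` (columns `B_{j_t}`) and the vector `B_{i₁}`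
  have hcr := _root_.Matrix.mulVec_cramer MJ.transpose (B (I ⟨0, h⟩))
  rw [_root_.Matrix.det_transpose, _root_.Matrix.mulVec_transpose, _root_.Matrix.vecMul_eq_sum]
    at hcr
  have hcramer : ∀ t, MJ.transpose.cramer (B (I ⟨0, h⟩)) t =
      (MJ.updateRow t (B (I ⟨0, h⟩))).det := by
    intro t
    rw [_root_.Matrix.cramer_apply, _root_.Matrix.updateCol_transpose, _root_.Matrix.det_transpose]
  simp only [hcramer] at hcr
  -- apply the linear functional `w ↦ det(w, B_{i₂}, …, B_{iₙ})`
  have key := congrArg (fun w => (MI.updateRow ⟨0, h⟩ w).det) hcr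
  rw [ShortPluecker.det_updateRow_sum, _root_.Matrix.det_updateRow_smul] at key
  have hself : MI.updateRow ⟨0, h⟩ (B (I ⟨0, h⟩)) = MI := _root_.Matrix.updateRow_eq_self MI ⟨0, h⟩
  rw [hself] at key
  -- identify the updated index tuples with updated rows
  have hI : ∀ t, (_root_.Matrix.of fun a => B (Function.update I ⟨0, h⟩ (J t) a)) =
      MI.updateRow ⟨0, h⟩ (MJ t) := by
    intro t
    ext a b
    simp only [_root_.Matrix.of_apply, _root_.Matrix.updateRow_apply, Function.update_apply, hMI, hMJ]
    split_ifs <;> rfl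
  have hJ : ∀ t, (_root_.Matrix.of fun a => B (Function.update J t (I ⟨0, h⟩) a)) =
      MJ.updateRow t (B (I ⟨0, h⟩)) := by
    intro t
    ext a b
    simp only [_root_.Matrix.of_apply, _root_.Matrix.updateRow_apply, Function.update_apply, hMJ]
    split_ifs <;> rfl
  simp only [hI, hJ]
  rw [mul_comm, ← key]
  exact Finset.sum_congr rfl fun t _ => mul_comm _ _

/-- **DISCHARGE of `FallatJohnson2011_shortPlueckerRelation`** (Fallat–Johnson 2011, §1.2, "the
short Plücker relation"): `[i,i',Δ][j,j',Δ] + [i,j',Δ][i',j,Δ] = [i,j,Δ][i',j',Δ]`, over any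
commutative ring (the printed side conditions `i < i' < j < j'`, `Δ` avoiding them, are not used).
Proof: the `s = 1` quadratic relation for `I = (i,i',Δ)`, `J = (j,j',Δ)`, in which only the terms
`t = 1, 2` survive (the others repeat a row of `Δ`), and `[y,x,Δ] = −[x,y,Δ]`.
[cite: FallatJohnson2011, §1.2, "the short Plücker relation" (PDF p. 36)] -/
theorem FallatJohnson2011_shortPlueckerRelation_holds : FallatJohnson2011_shortPlueckerRelation := by
  intro R _ m N B Δ i i' j j' _ _ _ _
  classical
  -- the coordinates as maximal minors with rows indexed by `Fin.cons x (Fin.cons y Δ)`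
  have hcoord : ∀ x y : Fin N, plueckerCoord B Δ x y =
      (_root_.Matrix.of fun a => B ((Fin.cons x (Fin.cons y Δ) : Fin (m + 2) → Fin N) a)).det := by
    intro x y
    unfold plueckerCoord
    congr 1
    ext a b
    simp only [_root_.Matrix.of_apply]
    refine Fin.cases ?_ (fun a' => ?_) a
    · rw [Fin.cons_zero, Fin.cons_zero]
    · rw [Fin.cons_succ, Fin.cons_succ]
      refine Fin.cases ?_ (fun s => ?_) a'
      · rw [Fin.cons_zero, Fin.cons_zero]
      · rw [Fin.cons_succ, Fin.cons_succ]
  -- the `s = 1` relation for `I = (i, i', Δ)`, `J = (j, j', Δ)`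
  have hrel := FallatJohnson2011_plueckerRelations_one_holds R (m + 2) N B
    (Fin.cons i (Fin.cons i' Δ)) (Fin.cons j (Fin.cons j' Δ)) (Nat.succ_pos _)
  rw [Fin.sum_univ_succ, Fin.sum_univ_succ] at hrel
  -- the terms `t ≥ 3` vanish: the row `Δ_s` is repeated
  have hvan : ∀ s : Fin m, (_root_.Matrix.of fun a => B (Function.update
      (Fin.cons i (Fin.cons i' Δ) : Fin (m + 2) → Fin N) ⟨0, Nat.succ_pos _⟩
      ((Fin.cons j (Fin.cons j' Δ) : Fin (m + 2) → Fin N) s.succ.succ) a)).det = 0 := by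
    intro s
    refine _root_.Matrix.det_zero_of_row_eq (i := 0) (j := s.succ.succ) (Fin.succ_ne_zero _).symm ?_
    ext b
    simp only [_root_.Matrix.of_apply]
    rw [show (⟨0, Nat.succ_pos _⟩ : Fin (m + 2)) = 0 from rfl, Function.update_self,
      Function.update_of_ne (Fin.succ_ne_zero _), Fin.cons_succ, Fin.cons_succ, Fin.cons_succ,
      Fin.cons_succ]
  simp only [hvan, zero_mul, Finset.sum_const_zero, add_zero] at hrel
  -- the two surviving terms
  rw [show (⟨0, Nat.succ_pos _⟩ : Fin (m + 2)) = 0 from rfl] at hrel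
  have e1 : Function.update (Fin.cons i (Fin.cons i' Δ) : Fin (m + 2) → Fin N) 0
      ((Fin.cons j (Fin.cons j' Δ) : Fin (m + 2) → Fin N) 0) = Fin.cons j (Fin.cons i' Δ) := by
    rw [Fin.cons_zero, Fin.update_cons_zero]
  have e2 : Function.update (Fin.cons j (Fin.cons j' Δ) : Fin (m + 2) → Fin N) 0
      ((Fin.cons i (Fin.cons i' Δ) : Fin (m + 2) → Fin N) 0) = Fin.cons i (Fin.cons j' Δ) := by
    rw [Fin.cons_zero, Fin.update_cons_zero]
  have e3 : Function.update (Fin.cons i (Fin.cons i' Δ) : Fin (m + 2) → Fin N) 0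
      ((Fin.cons j (Fin.cons j' Δ) : Fin (m + 2) → Fin N) (Fin.succ 0)) =
      Fin.cons j' (Fin.cons i' Δ) := by
    rw [Fin.cons_succ, Fin.cons_zero, Fin.update_cons_zero]
  have e4 : Function.update (Fin.cons j (Fin.cons j' Δ) : Fin (m + 2) → Fin N) (Fin.succ 0)
      ((Fin.cons i (Fin.cons i' Δ) : Fin (m + 2) → Fin N) 0) = Fin.cons j (Fin.cons i Δ) := by
    rw [Fin.cons_zero, ← Fin.cons_update, Fin.update_cons_zero]
  rw [e1, e2, e3, e4, ← hcoord, ← hcoord, ← hcoord, ← hcoord, ← hcoord, ← hcoord] at hrel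
  -- `[j,i',Δ] = −[i',j,Δ]`, `[j',i',Δ] = −[i',j',Δ]`, `[j,i,Δ] = −[i,j,Δ]`
  rw [ShortPluecker.plueckerCoord_swap B Δ i' j, ShortPluecker.plueckerCoord_swap B Δ i' j',
    ShortPluecker.plueckerCoord_swap B Δ i j] at hrel
  linear_combination hrel

end Literature.LinearAlgebra.Matrix
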